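import Summits.BirchSwinnertonDyer.Rank1Residual.X5.TwoAdicTargetsMultPub
import HarnessLib

/-!
# O1 (X5 at `p = 2`, non-CM): the non-split control slot `TwoAdicEulerCharRankZeroNonsplitMult W 0`
# from the GUARDED twin of Greenberg's display (audit N-1(a): A235 re-typed to `…_oddLocalDegree`)

HONEST FRAMING (cell `b2b-bsdres` / `bsd-2adic`, verbatim in every file): the goal of the cell is to
DELETE the COMBINATION-SHAPED residual classes of the Birch–Swinnerton-Dyer formula for ALL
analytic-rank `≤ 1` elliptic curves over `ℚ` assembled STRICTLY from published theorems, so that the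
rank-`≤ 1` remainder becomes exactly the CONSTRUCTION-SHAPED classes, which are TYPED, NOT attempted.
This is not "finishing BSD". Research routes; no claim beyond stated classes; nothing here is booked.

WHY THIS FILE (seat bsd-2adic-mult-3 GEN 3, D-audit `HOME/audit/D-AUDIT-h41-Gr99-Thm41-mult-analogue-at-2.md`
@f526883ecb786716, verdict V2 and recipe N-1): the parity-free named fact A235
`Greenberg1999.thm41Analogue_charValue_rankZero_numberField_anyPrime` displays `l_v = 2` at EVERY
non-split multiplicative `v ∣ 2` of EVERY number field `F`; print's own §3 Note (LNM 1716, held copy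
`book:coates1999-arithmetic-theory-elliptic-curves` chunk p0093 L15: the case `(F_∞)_η ⊇ F_v^{unr}`-quadratic,
e.g. `F = ℚ(√10)`) gives `|ker(r_v)| ≤ 1` there, so A235 as a `∀ F` statement is CONTRADICTED by its
source and a binder `(h41 : A235)` risks vacuity. The literature seat landed the guarded twin
`…_anyPrime_oddLocalDegree` (p425330; extra hypothesis «`p = 2` → every multiplicative `v ∋ 2` has odd
local degree», which forces print's generic case and is automatic over `ℚ`) with the PROVED projection
`….nonsplit_two` whose statement is IDENTICAL to A235's `….nonsplit_two`. This module is the twin of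
`X5/TwoAdicTargetsMultPub.lean` (cc-typer-4) on that binder: the glue
`twoAdicEulerCharRankZeroNonsplitMult_zero_of_greenberg'` (the audit's N-1(a), kernel-checked there as
`audit/d_audit_h41_glue_twin_check.lean`) and the three α-ns consumers with `(h41 : …_oddLocalDegree)`.
A NEW module rather than an append to `TwoAdicTargetsMultPub.lean`: nothing that imports the old glue is
rebuilt, and every consumer (the `X5/TwoAdicInstances*` files, the route's Theorems bridges) can migrate by
importing this file and adding a prime. Conclusions are byte-identical to the unprimed theorems; the old
ones stay (they are DERIVED from these by `…_oddLocalDegree_of_anyPrime`, see the `example` after the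
glue). 0 defs; nothing asserted; nothing booked.
PARTITION: X5@2 multiplicative (RESIDUAL-MAP B1·O1; 1 976 book230 classes) × p = 2 — types-the-object-of
(the PRINT binder of every non-split mult door); closes none. bears_on: K4
(route-BirchSwinnertonDyer-ByReductionTypeAtTwo items 19922/19923; D-audit h41).
-/

noncomputable section

open scoped Classical MatrixGroups ModularForm

open CongruenceSubgroup WeierstrassCurve Literature.NumberTheory.EllipticCurves
  Literature.NumberTheory.EllipticCurves.ModularForms
  Literature.NumberTheory.EllipticCurves.Greenberg1999
  Literature.NumberTheory.EllipticCurves.Rank1Residual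
  Literature.NumberTheory.EllipticCurves.Rank1Residual.Typed

set_option autoImplicit false

namespace Summit.BirchSwinnertonDyer.Rank1Residual.X5.O1

variable (W : WeierstrassCurve ℚ) [W.IsElliptic] [W.IsGloballyMinimal]

omit [W.IsGloballyMinimal] in
/-- **`TwoAdicEulerCharRankZeroNonsplitMult W 0` from the GUARDED twin of Greenberg's display (audit
N-1(a)).** Given `Greenberg1999.thm41Analogue_charValue_rankZero_numberField_anyPrime_oddLocalDegree`
(Greenberg, LNM 1716, §4 pp. 112–113 "the analogue of theorem 4.1", `l_v = 2` at a non-split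
multiplicative `v` with `|ker(r_v)| = 2c_v^{(p)}` for `p = 2`, restricted to print's generic case «odd
local degree at the multiplicative `v ∋ 2`» — automatic over `ℚ`), the O1 control target at a non-split
multiplicative `2` holds with `δ = 0`: `f_E(0) · #E(ℚ)(2)² = u · 2^{ord₂ ∏ c_ℓ + 1} · #Sel_{2^∞}(E/ℚ)`.
Same proof as `twoAdicEulerCharRankZeroNonsplitMult_zero_of_greenberg`, calling the twin's
`….nonsplit_two` (identical statement).
[cite: GreenbergLNM1716, §4 pp. 112–113 (held copy `book:coates1999-arithmetic-theory-elliptic-curves` p0112 L3–L7, p0113 L1) and §3 p0093 L15] -/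
theorem twoAdicEulerCharRankZeroNonsplitMult_zero_of_greenberg'
    (h : thm41Analogue_charValue_rankZero_numberField_anyPrime_oddLocalDegree) :
    TwoAdicEulerCharRankZeroNonsplitMult W 0 := by
  intro hmult hns κ γ hκ hγ _hγ' D _ hX fE hfE hfin
  obtain ⟨u, hu⟩ := h.nonsplit_two W hmult hns κ γ hκ hγ D hX fE hfE hfin
  refine ⟨u, ?_⟩
  rw [add_zero, zpow_natCast]
  exact hu

omit [W.IsGloballyMinimal] in
/-- The slack slot is inert on the twin as well: any `δ`-instance with `δ = 0` is the printed display.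
Bookkeeping twin of `twoAdicEulerCharRankZeroNonsplitMult_of_greenberg_of_eq_zero`. [folklore] -/
theorem twoAdicEulerCharRankZeroNonsplitMult_of_greenberg'_of_eq_zero
    (h : thm41Analogue_charValue_rankZero_numberField_anyPrime_oddLocalDegree) {δ : ℤ}
    (hδ : δ = 0) : TwoAdicEulerCharRankZeroNonsplitMult W δ := by
  subst hδ
  exact twoAdicEulerCharRankZeroNonsplitMult_zero_of_greenberg' W h

-- Migration certificate (an `example`, not a declaration: its statement coincides with the landed
-- unprimed glue): the A235 glue factors through the twin glue via `…_oddLocalDegree_of_anyPrime`, so a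
-- consumer that re-types `(h41 : A235)` to the twin loses nothing it could state over `ℚ`.
example (h : thm41Analogue_charValue_rankZero_numberField_anyPrime) :
    TwoAdicEulerCharRankZeroNonsplitMult W 0 :=
  twoAdicEulerCharRankZeroNonsplitMult_zero_of_greenberg' W
    (thm41Analogue_charValue_rankZero_numberField_anyPrime_oddLocalDegree_of_anyPrime h)

/-- **α-ns upper half with the control slot PUBLISHED on the twin.** Twin of
`missingUpperBoundAt_two_nonsplit_of_prop514_of_greenberg` with `h41` re-typed to
`…_anyPrime_oddLocalDegree`: on a curve with non-split multiplicative reduction at `2`, analytic rank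
`0`, and a ramified-XOR-odd rational `2`-torsion point (Prop. 5.14 locus), the inputs of
`MissingUpperBoundAt W 2` are PRINT {`prop514_isTorsion_mu_eq_zero_two`, the guarded Thm-4.1 analogue,
modularity, GZK} + K11a (`hK`, NOT in print) + the Néron-integrality certificate (`hint`).
[cite: GreenbergLNM1716, Prop. 5.14 (p. 121) and §4 pp. 112–113] [cite: Miller2011LMS, Def. 1.1] -/
theorem missingUpperBoundAt_two_nonsplit_of_prop514_of_greenberg'
    (h514 : prop514_isTorsion_mu_eq_zero_two)
    (h41 : thm41Analogue_charValue_rankZero_numberField_anyPrime_oddLocalDegree)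
    (hmod : nonempty_modularParametrizationData)
    (hGZK : rank_eq_analyticRank_of_analyticRank_le_one)
    (hK : ∀ [NeZero (W.conductorNorm ℤ)] (f : CuspForm (Gamma0 (W.conductorNorm ℤ)) 2)
      (L : PowerSeries ℚ_[2]), KatoDivisibilityAtTwoNonsplitMultRat W f L)
    (hint : ∀ [NeZero (W.conductorNorm ℤ)] (f : CuspForm (Gamma0 (W.conductorNorm ℤ)) 2),
      IsNewformOf W f → ∀ ϖ : ℚ, (ϖ : ℝ) * W.realPeriodRat = plusPeriod f →
      ∀ L : PowerSeries ℚ_[2], IsMultPAdicLFunctionOf f 2 (-1) L →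
        ∃ L₀ : IwasawaAlgebra 2, iwasawaToPowerSeries 2 L₀ = PowerSeries.C (ϖ : ℚ_[2]) * L)
    (hr : W.analyticRank = 0) (hmult : Mult W 2) (hns : ¬ W.HasSplitMultiplicativeReductionAtPrime 2)
    {x y : ℚ} (hP : W.toAffine.Equation x y) (h2 : 2 * y + W.a₁ * x + W.a₃ = 0)
    (hΦ : (TwoTorsionRamifiedAtTwo x ∧ ¬ TwoTorsionOdd W x) ∨
      (TwoTorsionOdd W x ∧ ¬ TwoTorsionRamifiedAtTwo x)) : MissingUpperBoundAt W 2 :=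
  missingUpperBoundAt_two_nonsplit_of_prop514 W h514
    (twoAdicEulerCharRankZeroNonsplitMult_zero_of_greenberg' W h41) hmod hGZK hK hint hr hmult hns
    hP h2 hΦ

/-- **α-ns END-STATE per pair with the control slot PUBLISHED on the twin: `BSD(E,2)` on the Prop. 5.14
locus at a non-split multiplicative `2` from the lower half.** Twin of
`bsdp_two_nonsplit_of_prop514_of_lowerBound_of_greenberg` with `h41` re-typed. What is NOT a published
theorem among the inputs: K11a (`hK`), and the two certificates `hint`, `hlow`. Nothing is booked.
[cite: GreenbergLNM1716, Prop. 5.14 (p. 121) and §4 pp. 112–113] [cite: Miller2011LMS, Def. 1.1 and §1] -/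
theorem bsdp_two_nonsplit_of_prop514_of_lowerBound_of_greenberg'
    (h514 : prop514_isTorsion_mu_eq_zero_two)
    (h41 : thm41Analogue_charValue_rankZero_numberField_anyPrime_oddLocalDegree)
    (hmod : nonempty_modularParametrizationData)
    (hGZK : rank_eq_analyticRank_of_analyticRank_le_one)
    (hK : ∀ [NeZero (W.conductorNorm ℤ)] (f : CuspForm (Gamma0 (W.conductorNorm ℤ)) 2)
      (L : PowerSeries ℚ_[2]), KatoDivisibilityAtTwoNonsplitMultRat W f L)
    (hint : ∀ [NeZero (W.conductorNorm ℤ)] (f : CuspForm (Gamma0 (W.conductorNorm ℤ)) 2),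
      IsNewformOf W f → ∀ ϖ : ℚ, (ϖ : ℝ) * W.realPeriodRat = plusPeriod f →
      ∀ L : PowerSeries ℚ_[2], IsMultPAdicLFunctionOf f 2 (-1) L →
        ∃ L₀ : IwasawaAlgebra 2, iwasawaToPowerSeries 2 L₀ = PowerSeries.C (ϖ : ℚ_[2]) * L)
    (hr : W.analyticRank = 0) (hmult : Mult W 2) (hns : ¬ W.HasSplitMultiplicativeReductionAtPrime 2)
    {x y : ℚ} (hP : W.toAffine.Equation x y) (h2 : 2 * y + W.a₁ * x + W.a₃ = 0)
    (hΦ : (TwoTorsionRamifiedAtTwo x ∧ ¬ TwoTorsionOdd W x) ∨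
      (TwoTorsionOdd W x ∧ ¬ TwoTorsionRamifiedAtTwo x))
    (hlow : MissingLowerBoundAt W 2) : BSDp W 2 :=
  bsdp_two_nonsplit_of_prop514_of_lowerBound W h514
    (twoAdicEulerCharRankZeroNonsplitMult_zero_of_greenberg' W h41) hmod hGZK hK hint hr hmult hns
    hP h2 hΦ hlow

/-- **The general non-split consumer with the control slot PUBLISHED on the twin.** Twin of
`missingUpperBoundAt_two_nonsplit_of_mu_eq_zero_of_greenberg` with `h41` re-typed: rank `0`, non-split
multiplicative `2`, K11a (`hK`) + `μ₂(X) = 0` for the cyclotomic data (`hμ`) + `hint` ⇒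
`MissingUpperBoundAt W 2`, modulo modularity and GZK by name.
[cite: GreenbergLNM1716, §4 pp. 112–113] [cite: Miller2011LMS, Def. 1.1] -/
theorem missingUpperBoundAt_two_nonsplit_of_mu_eq_zero_of_greenberg'
    (h41 : thm41Analogue_charValue_rankZero_numberField_anyPrime_oddLocalDegree)
    (hmod : nonempty_modularParametrizationData)
    (hGZK : rank_eq_analyticRank_of_analyticRank_le_one)
    (hK : ∀ [NeZero (W.conductorNorm ℤ)] (f : CuspForm (Gamma0 (W.conductorNorm ℤ)) 2)
      (L : PowerSeries ℚ_[2]), KatoDivisibilityAtTwoNonsplitMultRat W f L)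
    (hμ : ∀ (κ : ZpExtension ℚ 2) (γ : Field.absoluteGaloisGroup ℚ), κ.IsCyclotomic →
      κ.IsTopGenerator γ → IsCyclotomicVariable 2 γ → ∀ D : W.SelmerDualData κ γ, D.mu = 0)
    (hint : ∀ [NeZero (W.conductorNorm ℤ)] (f : CuspForm (Gamma0 (W.conductorNorm ℤ)) 2),
      IsNewformOf W f → ∀ ϖ : ℚ, (ϖ : ℝ) * W.realPeriodRat = plusPeriod f →
      ∀ L : PowerSeries ℚ_[2], IsMultPAdicLFunctionOf f 2 (-1) L →
        ∃ L₀ : IwasawaAlgebra 2, iwasawaToPowerSeries 2 L₀ = PowerSeries.C (ϖ : ℚ_[2]) * L)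
    (hr : W.analyticRank = 0) (hmult : Mult W 2)
    (hns : ¬ W.HasSplitMultiplicativeReductionAtPrime 2) : MissingUpperBoundAt W 2 :=
  missingUpperBoundAt_two_nonsplit_of_mu_eq_zero W
    (twoAdicEulerCharRankZeroNonsplitMult_zero_of_greenberg' W h41) hmod hGZK hK hμ hint hr hmult hns

end Summit.BirchSwinnertonDyer.Rank1Residual.X5.O1

end
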